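import Summits.Ventures.HSemireg.WedgeHankelRecurrenceGaussChebyshevSupNorms

/-!
# Venture HSemireg — **LEBESGUE INTEGRALS OVER THE INTERVAL: `∫_{−1}^{1} U_n(x) dx = (1 + (−1)^n)∕(n+1)`, `∫_{−2}^{2} S_n(x) dx = 2(1 + (−1)^n)∕(n+1)`, `∫_{−2}^{2} C_n(x) dx = 4(1 + (−1)^n)∕(1 − n²)`**
# (antiderivative `T_{n+1}∕(n+1)` of `U_n`; `S_n(x) = U_n(x∕2)`; `C_{n+2} = S_{n+2} − S_n`; the `T`-integral `∫_{−1}^{1} T_m = (1 + (−1)^m)∕(1 − m²)` is the LANDED `Literature.Analysis.Quadrature.integral_chebyshevT`)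

HONEST FRAMING. Part of the Lean index of the computation cell `pub-hsemireg` (seat p10 gen 49, Sunday typer «UNIFORM-IN-n»).  One-variable real calculus only (Mathlib `intervalIntegral`, `Polynomial.hasDerivAt`,
`Polynomial.Chebyshev.T_derivative_eq_U`); no variety, no cohomology theory, no sheaf, no Ext group and no semiregularity map is constructed here; nothing here says that HC / HC_CM / HC_AV holds; no
Literature fact (unproved `Prop`) is declared or used.  Custodian versions as in `WedgeHankelSiegelIdeal` (1/3).
SOURCES (cited).  P. J. Davis, P. Rabinowitz, *Methods of Numerical Integration* (2nd ed. 1984), §2.5.5, (2.5.5.4) (`∫_{−1}^{1} T_m`); J. C. Mason, D. C. Handscomb, *Chebyshev Polynomials* (2003), §2.4.4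
(`∫ U_n = T_{n+1}∕(n+1)`); NIST DLMF §18.9(iii).
PROOF TYPED HERE.  (1) `d∕dx T_{n+1}(x)∕(n+1) = U_n(x)` (Mathlib `T_derivative_eq_U`, `Polynomial.hasDerivAt`) and the fundamental theorem (`intervalIntegral.integral_eq_sub_of_hasDerivAt`) with `T_{n+1}(±1) =
(±1)^{n+1}`; (2) `S_n(x) = U_n(x∕2)` (N521) and `intervalIntegral.integral_comp_div`; (3) `C_{n+2} = S_{n+2} − S_n` (Mathlib `C_eq_S_sub_X_mul_S`, `S_add_two`), `intervalIntegral.integral_sub`,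
and the cases `n = 0, 1` (`∫ 2 = 8`, `∫ x = 0`).
DEDUP DISCLOSURE (`rg -n '..1, \\((Polynomial.)?(Chebyshev.)?(T|U) ℝ|..2, \\(.*(S|C) ℝ' Summits Literature`, 2026-09-04): `Literature.Analysis.Quadrature.integral_chebyshevT` (FejerRules, `∫_{−1}^{1} T_m`, CITED — not
restated and not imported: that file does `import Mathlib`) and weighted `T`-integrals in `GaussChebyshevRules` ∕ `ChebyshevLegendreFourier`; no `U ∕ S ∕ C` Lebesgue integral; 0 hits for the 6
names below.

WHAT IS IN THE TREE.  N521 `chebyshevS_eval_eq_U_eval_half`, `chebyshevC_eval_eq_two_mul_T_eval_half`; Mathlib `T_derivative_eq_U`, `C_eq_S_sub_X_mul_S`, `S_add_two`, `T_eval_one`, `T_eval_neg`, `Polynomial.hasDerivAt`,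
`Polynomial.continuous`, `intervalIntegral.integral_eq_sub_of_hasDerivAt`, `intervalIntegral.integral_comp_div`, `intervalIntegral.integral_sub`, `intervalIntegral.integral_const`, `integral_id`.
THIS FILE (namespace `Summit.Ventures.HSemireg.Wedge.HankelOuter` continued; CHAINED on N534; 0 definitions):
* §1300 `hasDerivAt_chebyshevT_succ_div` (`(T_{n+1}∕(n+1))' = U_n`), **`integral_chebyshevU_real`** (`∫_{−1}^{1} U_n = (1 + (−1)^n)∕(n+1)`), **`integral_chebyshevS_real`** (`∫_{−2}^{2} S_n = 2(1 + (−1)^n)∕(n+1)`),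
  `chebyshevC_add_two_eq_S_sub_S` (`C_{n+2} = S_{n+2} − S_n`, every commutative ring), **`integral_chebyshevC_real`** (`∫_{−2}^{2} C_n = 4(1 + (−1)^n)∕(1 − n²)`, all `n ∈ ℕ`;
  `n = 1`: `0 = 0∕0`), `integral_chebyshevU_real_odd` (`= 0` for odd `n`).
CAVEATS.  `n ∈ ℕ`.  Nothing Ext-side.  New names only.
-/

open Module Polynomial
open scoped Matrix Polynomial

namespace Summit.Ventures.HSemireg.Wedge.HankelOuter

/-! ## §1300. `∫_{−1}^{1} U_n`, `∫_{−2}^{2} S_n`, `∫_{−2}^{2} C_n` -/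

/-- `(T_{n+1}(x)∕(n+1))' = U_n(x)` (Mathlib `T_derivative_eq_U`). [Mason–Handscomb 2003, §2.4.4; this file, §1300] -/
theorem hasDerivAt_chebyshevT_succ_div (n : ℕ) (x : ℝ) :
    HasDerivAt (fun x : ℝ => (Polynomial.Chebyshev.T ℝ ((n + 1 : ℕ) : ℤ)).eval x / ((n : ℝ) + 1)) ((Polynomial.Chebyshev.U ℝ (n : ℤ)).eval x) x := by
  have hn : ((n : ℝ) + 1) ≠ 0 := by positivity
  have h := (Polynomial.hasDerivAt (Polynomial.Chebyshev.T ℝ ((n + 1 : ℕ) : ℤ)) x).div_const ((n : ℝ) + 1)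
  rw [Polynomial.Chebyshev.T_derivative_eq_U, show ((n + 1 : ℕ) : ℤ) - 1 = (n : ℤ) by push_cast; ring, eval_mul, eval_intCast] at h
  have e : (((((n + 1 : ℕ) : ℤ)) : ℝ) * (Polynomial.Chebyshev.U ℝ (n : ℤ)).eval x) / ((n : ℝ) + 1) = (Polynomial.Chebyshev.U ℝ (n : ℤ)).eval x := by
    push_cast
    field_simp
  rw [e] at h
  exact h

/-- **`∫_{−1}^{1} U_n(x) dx = (1 + (−1)^n)∕(n+1)`** (`= 2∕(n+1)` for even `n`, `0` for odd `n`). [Mason–Handscomb 2003, §2.4.4; DLMF 18.9(iii); this file, §1300] -/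
theorem integral_chebyshevU_real (n : ℕ) : ∫ x in (-1 : ℝ)..1, (Polynomial.Chebyshev.U ℝ (n : ℤ)).eval x = (1 + (-1) ^ n) / ((n : ℝ) + 1) := by
  rw [intervalIntegral.integral_eq_sub_of_hasDerivAt (fun x _ => hasDerivAt_chebyshevT_succ_div n x) ((Polynomial.continuous _).intervalIntegrable _ _)]
  simp only [Polynomial.Chebyshev.T_eval_neg, Polynomial.Chebyshev.T_eval_one, Int.cast_negOnePow_natCast, mul_one]
  rw [pow_succ]
  ring

/-- `∫_{−1}^{1} U_n(x) dx = 0` for odd `n`. [this file, §1300] -/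
theorem integral_chebyshevU_real_odd {n : ℕ} (hn : Odd n) : ∫ x in (-1 : ℝ)..1, (Polynomial.Chebyshev.U ℝ (n : ℤ)).eval x = 0 := by
  rw [integral_chebyshevU_real, hn.neg_one_pow]
  ring

/-- **`∫_{−2}^{2} S_n(x) dx = 2(1 + (−1)^n)∕(n+1)`** (`S_n(x) = U_n(x∕2)`). [Mason–Handscomb 2003, §2.4.4; this file, §1300] -/
theorem integral_chebyshevS_real (n : ℕ) : ∫ x in (-2 : ℝ)..2, (Polynomial.Chebyshev.S ℝ (n : ℤ)).eval x = 2 * (1 + (-1) ^ n) / ((n : ℝ) + 1) := by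
  simp_rw [chebyshevS_eval_eq_U_eval_half]
  rw [intervalIntegral.integral_comp_div (fun x => (Polynomial.Chebyshev.U ℝ (n : ℤ)).eval x) two_ne_zero, show (-2 : ℝ) / 2 = -1 by norm_num, show (2 : ℝ) / 2 = 1 by norm_num,
    integral_chebyshevU_real, smul_eq_mul]
  ring

/-- `C_{n+2} = S_{n+2} − S_n` in every commutative ring (`C_{n+2} = 2S_{n+2} − X·S_{n+1}` and `X·S_{n+1} = S_{n+2} + S_n`, Mathlib `C_eq_S_sub_X_mul_S`, `S_add_two`). [this file, §1300] -/
theorem chebyshevC_add_two_eq_S_sub_S (R : Type*) [CommRing R] (n : ℤ) :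
    Polynomial.Chebyshev.C R (n + 2) = Polynomial.Chebyshev.S R (n + 2) - Polynomial.Chebyshev.S R n := by
  have h := Polynomial.Chebyshev.S_add_two R n
  rw [Polynomial.Chebyshev.C_eq_S_sub_X_mul_S, show n + 2 - 1 = n + 1 by ring]
  linear_combination h

/-- **`∫_{−2}^{2} C_n(x) dx = 4(1 + (−1)^n)∕(1 − n²)`** for every `n ∈ ℕ` (`n = 1`: both sides `0`, the right one as `0∕0`; the `T`-version on `[−1, 1]` is `Literature.Analysis.Quadrature.integral_chebyshevT`).
[Davis–Rabinowitz 1984, (2.5.5.4); this file, §1300] -/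
theorem integral_chebyshevC_real (n : ℕ) : ∫ x in (-2 : ℝ)..2, (Polynomial.Chebyshev.C ℝ (n : ℤ)).eval x = 4 * (1 + (-1) ^ n) / (1 - (n : ℝ) ^ 2) := by
  rcases Nat.lt_or_ge n 2 with hn | hn
  · interval_cases n
    · simp only [Nat.cast_zero, Polynomial.Chebyshev.C_zero, eval_ofNat, intervalIntegral.integral_const, smul_eq_mul]
      norm_num
    · simp only [Nat.cast_one, Polynomial.Chebyshev.C_one, eval_X, integral_id]
      norm_num
  · obtain ⟨k, rfl⟩ : ∃ k, n = k + 2 := ⟨n - 2, by omega⟩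
    have hS : ∀ m : ℕ, IntervalIntegrable (fun x : ℝ => (Polynomial.Chebyshev.S ℝ (m : ℤ)).eval x) MeasureTheory.volume (-2 : ℝ) 2 :=
      fun m => (Polynomial.continuous _).intervalIntegrable _ _
    have e : ∀ x : ℝ, (Polynomial.Chebyshev.C ℝ ((k + 2 : ℕ) : ℤ)).eval x =
        (Polynomial.Chebyshev.S ℝ ((k + 2 : ℕ) : ℤ)).eval x - (Polynomial.Chebyshev.S ℝ (k : ℤ)).eval x := fun x => by
      rw [show ((k + 2 : ℕ) : ℤ) = (k : ℤ) + 2 by push_cast; ring, chebyshevC_add_two_eq_S_sub_S, eval_sub]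
    simp_rw [e]
    rw [intervalIntegral.integral_sub (hS (k + 2)) (hS k), integral_chebyshevS_real, integral_chebyshevS_real]
    have h1 : ((k : ℝ) + 1) ≠ 0 := by positivity
    have h3 : (((k + 2 : ℕ) : ℝ) + 1) ≠ 0 := by positivity
    have h4 : (1 - ((k + 2 : ℕ) : ℝ) ^ 2) ≠ 0 := ne_of_lt (by push_cast; nlinarith [Nat.cast_nonneg (α := ℝ) k])
    field_simp
    push_cast
    ring

end Summit.Ventures.HSemireg.Wedge.HankelOuter
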